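import Summits.CriticalPhenomena.PercolationContinuityZ3.Theorems.PercNearOneGluingNoHeavyLowerTailThreePartitionCubeCheck
import Summits.CriticalPhenomena.PercolationContinuityZ3.Theorems.PercNearOneGluingNoHeavyLowerTailThreePartitionPairSaturation
import Summits.CriticalPhenomena.PercolationContinuityZ3.Theorems.PercNearOneGluingNoHeavyLowerTailSahiC3CubeColourCheck

/-!
# Twisted three-partition positivity (★★) = (M⁺-3) on SIX letters: soundness of the checker, I — **the scalar profile IS `N_τ(𝒰,𝒱,{y})`**

Support file (cell `prim-sahi`, seat `prim-sahi-typer` gen 34; `--supports stmt-CriticalPhenomena-4575`).  Pure proofs, no `sorry`, standard axioms.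
For every `m`, all families `𝒰, 𝒱 ⊆ 2^(Fin m)`, every twist `τ` and every point `y`:
`(profileArr (mkTabs m) (encA m 𝒰) (encA m 𝒱) (encS τ)).getD (encS y) 0 = threePartNT τ 𝒰 𝒱 {y}` (`profileArr_encA`), granted the numeric identity
`2 <<< pc m r = 2·#{s < 2^m : s ⊆ r}` for the code `r` of `(y ∆ τ)ᶜ` (a finite check at `m = 6`, discharged in the assembly file).  Ingredients: the closed
form `ThreePartition.threePartNT_singleton₃_eq` (`…ThreePartitionPairSaturation`), the code/point dictionary of `…SahiC3CubeEvents/ColourCheck` (`pt`, `encS`,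
`encA`), `pt (x ⊕ t) = pt x ∆ pt t`, `pt (1…1 ⊕ x) = (pt x)ᶜ`, and the bijection `S ↦ encS S` between the subsets counted by `cntSub` and the codes counted by
the checker's folds over `subsL`. [this work]
-/

namespace Summit.CriticalPhenomena.PercolationContinuityZ3.Theorems.ThreePartition.Cube

open Finset SahiGridPattern.Pair43 SahiC3Cube
open scoped symmDiff Classical

variable {m : ℕ}

/-! ### Codes and points -/

/-- Two codes below `2^m` with the same point are equal. [this work] -/
theorem eq_of_pt_eq {x z : ℕ} (hx : x < 2 ^ m) (hz : z < 2 ^ m) (h : pt m x = pt m z) : x = z := by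
  refine Nat.eq_of_testBit_eq fun i => ?_
  by_cases hi : i < m
  · have h1 : (⟨i, hi⟩ : Fin m) ∈ pt m x ↔ (⟨i, hi⟩ : Fin m) ∈ pt m z := by rw [h]
    simp only [pt, Set.mem_setOf_eq] at h1
    cases hxi : x.testBit i <;> cases hzi : z.testBit i
    · rfl
    · exact absurd (h1.2 hzi) (by rw [hxi]; exact Bool.false_ne_true)
    · exact absurd (h1.1 hxi) (by rw [hzi]; exact Bool.false_ne_true)
    · rfl
  · have hm : 2 ^ m ≤ 2 ^ i := Nat.pow_le_pow_right (by norm_num) (not_lt.1 hi)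
    rw [Nat.testBit_lt_two_pow (lt_of_lt_of_le hx hm), Nat.testBit_lt_two_pow (lt_of_lt_of_le hz hm)]

/-- `encS (pt m x) = x` for `x < 2^m`. [this work] -/
theorem encS_pt {x : ℕ} (hx : x < 2 ^ m) : encS (pt m x) = x := eq_of_pt_eq (encS_lt _) hx (pt_encS _)

/-- `pt (x ⊕ t) = pt x ∆ pt t`. [this work] -/
theorem pt_xor (m x t : ℕ) : pt m (x ^^^ t) = pt m x ∆ pt m t := by
  ext i
  simp only [pt, Set.mem_setOf_eq, Nat.testBit_xor, Set.mem_symmDiff]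
  cases x.testBit i <;> cases t.testBit i <;> simp

/-- `pt ((2^m − 1) ⊕ x) = (pt x)ᶜ`. [this work] -/
theorem pt_allOnes_xor (m x : ℕ) : pt m ((2 ^ m - 1) ^^^ x) = (pt m x)ᶜ := by
  ext i
  simp only [pt, Set.mem_setOf_eq, Nat.testBit_xor, Nat.testBit_two_pow_sub_one, Set.mem_compl_iff, i.2, decide_true]
  cases x.testBit i <;> simp

/-- `sub x z` is containment of points (`x < 2^m`). [this work] -/
theorem sub_eq_true_iff {x : ℕ} (z : ℕ) (hx : x < 2 ^ m) : sub x z = true ↔ pt m x ⊆ pt m z := by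
  unfold sub
  rw [beq_iff_eq]
  exact land_eq_self_iff_pt_subset z hx

/-- `encS` of a symmetric difference. [this work] -/
theorem encS_symmDiff (y t : Set (Fin m)) : encS (y ∆ t) = encS y ^^^ encS t := by
  refine eq_of_pt_eq (encS_lt _) (Nat.xor_lt_two_pow (encS_lt _) (encS_lt _)) ?_
  rw [pt_encS, pt_xor, pt_encS, pt_encS]

/-- `encS` of a complement. [this work] -/
theorem encS_compl (y : Set (Fin m)) : encS yᶜ = (2 ^ m - 1) ^^^ encS y := by
  refine eq_of_pt_eq (encS_lt _) (Nat.xor_lt_two_pow (Nat.sub_one_lt (Nat.pos_iff_ne_zero.1 (Nat.two_pow_pos m))) (encS_lt _)) ?_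
  rw [pt_encS, pt_allOnes_xor, pt_encS]

/-! ### Counting: `cntSub` versus the codes `⊆ r` -/

/-- A counting fold is the length of a filter. [this work] -/
theorem foldl_count (L : List ℕ) (p : ℕ → Bool) (init : ℕ) :
    L.foldl (fun acc s => if p s then acc + 1 else acc) init = init + (L.filter p).length := by
  induction L generalizing init with
  | nil => simp
  | cons a L ih =>
    simp only [List.foldl_cons, List.filter_cons]
    cases p a <;> simp [ih, Nat.add_assoc, Nat.add_comm 1]

/-- **`cntSub` counts codes**: the subsets `S ⊆ R` with `P S` are in bijection (`S ↦ encS S`) with the codes `s < 2^m`, `s ⊆ encS R`, `q s`, for any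
Boolean test `q` agreeing with `P` on the points of such codes. [this work] -/
theorem cntSub_eq_length (R : Set (Fin m)) (P : Set (Fin m) → Prop) (q : ℕ → Bool)
    (hq : ∀ s, s < 2 ^ m → sub s (encS R) = true → (q s = true ↔ P (pt m s))) :
    cntSub R P = ((List.range (2 ^ m)).filter fun s => q s && sub s (encS R)).length := by
  have hnd : ((List.range (2 ^ m)).filter fun s => q s && sub s (encS R)).Nodup := (List.nodup_range).filter _
  rw [← List.toFinset_card_of_nodup hnd]
  unfold cntSub
  refine card_bij (fun S _ => encS S) (fun S hS => ?_) (fun S hS S' hS' h => ?_) (fun s hs => ?_)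
  · simp only [mem_filter, mem_univ, true_and] at hS
    simp only [List.mem_toFinset, List.mem_filter, List.mem_range, Bool.and_eq_true]
    have hsub : sub (encS S) (encS R) = true := by rw [sub_eq_true_iff _ (encS_lt S), pt_encS, pt_encS]; exact hS.1
    refine ⟨encS_lt S, ?_, hsub⟩
    rw [hq _ (encS_lt S) hsub, pt_encS]; exact hS.2
  · have := congrArg (pt m) h
    rwa [pt_encS, pt_encS] at this
  · simp only [List.mem_toFinset, List.mem_filter, List.mem_range, Bool.and_eq_true] at hs
    refine ⟨pt m s, ?_, encS_pt hs.1⟩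
    simp only [mem_filter, mem_univ, true_and]
    refine ⟨?_, (hq s hs.1 hs.2.2).1 hs.2.1⟩
    have h1 := (sub_eq_true_iff (encS R) hs.1).1 hs.2.2
    rwa [pt_encS] at h1

/-! ### The tables of `mkTabs` -/

/-- Reading an `Array.ofFn` inside its range. [this work] -/
theorem getD_ofFn {α : Type*} {n : ℕ} (f : Fin n → α) (d : α) {i : ℕ} (h : i < n) : (Array.ofFn f).getD i d = f ⟨i, h⟩ := by
  rw [Array.getD_eq_getD_getElem?, Array.getElem?_ofFn]; simp [h]

/-- `(mkTabs m).np = 2^m`. [this work] -/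
theorem mkTabs_np (m : ℕ) : (mkTabs m).np = 2 ^ m := by
  show 1 <<< m = 2 ^ m
  rw [Nat.one_shiftLeft]

/-- The subset lists. [this work] -/
theorem mkTabs_subsL_getD (m r : ℕ) (hr : r < 2 ^ m) :
    (mkTabs m).subsL.getD r #[] = ((List.range (2 ^ m)).filter fun s => sub s r).toArray := by
  have h1 : (mkTabs m).subsL = Array.ofFn fun r : Fin (1 <<< m) => ((List.range (1 <<< m)).filter fun s => sub s r).toArray := rfl
  have hr' : r < 1 <<< m := by rw [Nat.one_shiftLeft]; exact hr
  rw [h1, getD_ofFn _ _ hr']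
  show ((List.range (1 <<< m)).filter fun s => sub s r).toArray = _
  rw [Nat.one_shiftLeft]

/-- The coordinate counts. [this work] -/
theorem mkTabs_pcT_getD (m r : ℕ) (hr : r < 2 ^ m) : (mkTabs m).pcT.getD r 0 = pc m r := by
  have h1 : (mkTabs m).pcT = Array.ofFn fun x : Fin (1 <<< m) => pc m x := rfl
  have hr' : r < 1 <<< m := by rw [Nat.one_shiftLeft]; exact hr
  rw [h1, getD_ofFn _ _ hr']

/-! ### The scalar profile is `N_τ(𝒰,𝒱,{y})` -/

/-- Membership of the point of a code below `2^m` in a family, read off the family's mask. [this work] -/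
theorem testBit_encA_of_lt (A : Set (Set (Fin m))) {x : ℕ} (hx : x < 2 ^ m) : (encA m A).testBit x = decide (pt m x ∈ A) := by
  rw [testBit_encA]; simp [hx]

/-- **THE SCALAR PROFILE IS THE TWISTED THREE-PARTITION FUNCTIONAL WITH A SINGLETON THIRD SLOT.**  Granted the numeric identity
`2 <<< pc m r = 2·#{s < 2^m : s ⊆ r}` at the code `r` of `(y ∆ τ)ᶜ` (a finite check for `m = 6`):
`(profileArr (mkTabs m) (encA m 𝒰) (encA m 𝒱) (encS τ))[encS y] = N_τ(𝒰,𝒱,{y})`. [this work] -/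
theorem profileArr_encA (𝒰 𝒱 : Set (Set (Fin m))) (τ y : Set (Fin m))
    (hpow : 2 <<< pc m (encS (y ∆ τ)ᶜ) = 2 * ((List.range (2 ^ m)).filter fun s => sub s (encS (y ∆ τ)ᶜ)).length) :
    (profileArr (mkTabs m) (encA m 𝒰) (encA m 𝒱) (encS τ)).getD (encS y) 0 = threePartNT τ 𝒰 𝒱 {y} := by
  set T := mkTabs m with hT
  have hnp : T.np = 2 ^ m := mkTabs_np m
  have hy : encS y < T.np := by rw [hnp]; exact encS_lt y
  -- the code of `R = (y ∆ τ)ᶜ`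
  have hR : (T.np - 1) ^^^ (encS y ^^^ encS τ) = encS (y ∆ τ)ᶜ := by
    rw [hnp, encS_compl, encS_symmDiff]
  have hRlt : encS (y ∆ τ)ᶜ < 2 ^ m := encS_lt _
  -- points of the codes occurring in the folds
  have hpt1 : ∀ s, s < 2 ^ m → pt m (s ^^^ encS τ) = pt m s ∆ τ := fun s _ => by rw [pt_xor, pt_encS]
  have hpt2 : ∀ s, s < 2 ^ m → sub s (encS (y ∆ τ)ᶜ) = true →
      pt m ((encS (y ∆ τ)ᶜ ^^^ s) ^^^ encS τ) = ((y ∆ τ)ᶜ \ pt m s) ∆ τ := by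
    intro s hs hsub
    rw [pt_xor, pt_xor, pt_encS, pt_encS]
    have hle : pt m s ⊆ (y ∆ τ)ᶜ := by
      have := (sub_eq_true_iff _ hs).1 hsub; rwa [pt_encS] at this
    rw [symmDiff_of_ge hle]
  have hxlt : ∀ s, s < 2 ^ m → s ^^^ encS τ < 2 ^ m := fun s hs => Nat.xor_lt_two_pow hs (encS_lt τ)
  -- unfold the array entry
  rw [profileArr, getD_ofFn _ _ hy]
  simp only []
  rw [hR, mkTabs_subsL_getD m _ hRlt, mkTabs_pcT_getD m _ hRlt, hpow]
  simp only [List.foldl_toArray', foldl_count, Nat.zero_add, List.filter_filter]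
  -- the closed form, with the checker's Boolean tests as the counting predicates
  have hq0 : ∀ s, s < 2 ^ m → sub s (encS (y ∆ τ)ᶜ) = true → ((fun _ : ℕ => true) s = true ↔ (fun _ : Set (Fin m) => True) (pt m s)) :=
    fun _ _ _ => by simp
  have hqG : ∀ s, s < 2 ^ m → sub s (encS (y ∆ τ)ᶜ) = true →
      ((fun s => (encA m 𝒰).testBit (s ^^^ encS τ) && (encA m 𝒱).testBit ((encS (y ∆ τ)ᶜ ^^^ s) ^^^ encS τ)) s = true ↔
        (fun S : Set (Fin m) => S ∆ τ ∈ 𝒰 ∧ ((y ∆ τ)ᶜ \ S) ∆ τ ∈ 𝒱) (pt m s)) := by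
    intro s hs hsub
    have hlt2 : (encS (y ∆ τ)ᶜ ^^^ s) ^^^ encS τ < 2 ^ m := Nat.xor_lt_two_pow (Nat.xor_lt_two_pow hRlt hs) (encS_lt τ)
    simp only [Bool.and_eq_true]
    rw [testBit_encA_of_lt 𝒰 (hxlt s hs), testBit_encA_of_lt 𝒱 hlt2, hpt1 s hs, hpt2 s hs hsub, decide_eq_true_iff, decide_eq_true_iff]
  have hqX : ∀ 𝒳 : Set (Set (Fin m)), ∀ s, s < 2 ^ m → sub s (encS (y ∆ τ)ᶜ) = true →
      ((fun s => (encA m 𝒳).testBit (s ^^^ encS τ)) s = true ↔ (fun S : Set (Fin m) => S ∆ τ ∈ 𝒳) (pt m s)) := by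
    intro 𝒳 s hs _
    simp only []
    rw [testBit_encA_of_lt 𝒳 (hxlt s hs), hpt1 s hs, decide_eq_true_iff]
  have hqUV : ∀ s, s < 2 ^ m → sub s (encS (y ∆ τ)ᶜ) = true →
      ((fun s => (encA m 𝒰 &&& encA m 𝒱).testBit (s ^^^ encS τ)) s = true ↔ (fun S : Set (Fin m) => S ∆ τ ∈ 𝒰 ∩ 𝒱) (pt m s)) := by
    intro s hs _
    simp only [Nat.testBit_land, Bool.and_eq_true]
    rw [testBit_encA_of_lt 𝒰 (hxlt s hs), testBit_encA_of_lt 𝒱 (hxlt s hs), hpt1 s hs, decide_eq_true_iff, decide_eq_true_iff,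
      Set.mem_inter_iff]
  rw [threePartNT_singleton₃_eq, cntSub_eq_length _ _ _ hq0, cntSub_eq_length _ _ _ hqG, cntSub_eq_length _ _ _ (hqX 𝒰),
    cntSub_eq_length _ _ _ (hqX 𝒱), cntSub_eq_length _ _ _ hqUV, Nat.testBit_land, testBit_encA_of_lt 𝒰 (encS_lt y),
    testBit_encA_of_lt 𝒱 (encS_lt y), pt_encS]
  simp only [Bool.true_and]
  by_cases hU : y ∈ 𝒰 <;> by_cases hV : y ∈ 𝒱 <;> simp [hU, hV] <;> ring

end Summit.CriticalPhenomena.PercolationContinuityZ3.Theorems.ThreePartition.Cube
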